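import Summits.HodgeConjecture.HodgeCM.PerL34.AnnihilationModel_1

/-! PORT of `HodgeCM/PerL34/AnnihilationModel.lean` (HodgeCMPerL run 82) — part 2: continuation of `Summits.HodgeConjecture.HodgeCM.PerL34.AnnihilationModel_1` (split at a top-level declaration boundary by port_pkg.py; scope re-opened below; declarations unchanged). -/

-- port_pkg: scope re-opened for this part (file-level context, then the namespace/section stack open at the cut)
set_option autoImplicit false
noncomputable section
namespace HodgeCM
namespace PerL34.Annihilation
open MeasureTheory Filter Topology QuotientSmoothing
local notation "⟪" x ", " y "⟫" => @inner ℂ _ _ x y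
section CompactModel
variable {G : Type} [Group G] [TopologicalSpace G] [IsTopologicalGroup G] {Γ : Subgroup G}
  [MeasurableSpace (G ⧸ Γ)] [BorelSpace (G ⧸ Γ)] [CompactSpace (G ⧸ Γ)]
  (ν : Measure (G ⧸ Γ)) [IsFiniteMeasure ν]
variable {HG CG SK SigIdxG : Type}
variable [NormedAddCommGroup HG] [InnerProductSpace ℂ HG] [CompleteSpace HG]
variable [NormedAddCommGroup CG] [NormedSpace ℂ CG] [TopologicalSpace SK]
omit [IsTopologicalGroup G] [MeasurableSpace (G ⧸ Γ)] [BorelSpace (G ⧸ Γ)] in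
/-- `res_spec` for `res := resCLM φ`: it holds as soon as `φ (q a) = Γ·ιA(a)`, i.e. `φ (q a) = π((ιA a)⁻¹)`. -/
theorem resCLM_spec {K TA : Type} [TopologicalSpace K] [CompactSpace K] (φ : C(K, G ⧸ Γ)) (ιA : TA → G) (q : TA → K)
    (hφ : ∀ a, φ (q a) = (((ιA a)⁻¹ : G) : G ⧸ Γ)) (x : C(G ⧸ Γ, ℂ)) (a : TA) :
    resCLM φ x (q a) = evC (ιA a) x := by
  rw [resCLM_apply, hφ, evC_apply]

omit [MeasurableSpace (G ⧸ Γ)] [BorelSpace (G ⧸ Γ)] in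
/-- `res_transl` for `res := resCLM φ`: it holds as soon as `φ` is equivariant, `φ (k · cl t) = (ιT t)⁻¹ • φ k`. -/
theorem resCLM_transl {K Tc : Type} [TopologicalSpace K] [CompactSpace K] [Group K] [Group Tc] (φ : C(K, G ⧸ Γ))
    (ιT : Tc →* G) (cl : Tc →* K) (hφ : ∀ (k : K) (t : Tc), φ (k * cl t) = (ιT t)⁻¹ • φ k)
    (t : Tc) (x : C(G ⧸ Γ, ℂ)) (k : K) : resCLM φ (translC (ιT t) x) k = resCLM φ x (k * cl t) := by
  rw [resCLM_apply, resCLM_apply, translC_apply_apply, hφ]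

/-- **The annihilation datum over the cocompact model with a compact model `K` of `[T]`**: as `QuotientTorusDatum`, but the
characters of `[T]` ARE `PontryaginDual K`, the toric period IS `periodCLM μK ξ ∘ res` (`res` = restriction of a function on
`[U(W)]` to `[T]` along `ιA`), `PT_cov` is PROVED (from the equivariance `res_transl`) and `fourier` is PROVED OUTRIGHT —
point separation by characters of the compact Hausdorff abelian group `K` is pv06-g2's KERNEL theorem
`CharSeparation.charSeparating` (LANDED, run 22), so NO [PRINT] input remains on the Fourier side. -/
structure CompactTorusDatum (C : RepCoreCarrier (Lp ℂ 2 ν) HG CG G SK SigIdxG) (D : RepTorusCarrier C) where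
  /-- the compact group `T(L₀ ⊗ ℝ)` -/
  Tc : Type
  [instTc₁ : Group Tc]
  [instTc₂ : TopologicalSpace Tc]
  [instTc₃ : IsTopologicalGroup Tc]
  [instTc₄ : CompactSpace Tc]
  [instTc₅ : MeasurableSpace Tc]
  [instTc₆ : BorelSpace Tc]
  /-- its normalised Haar measure -/
  μ : Measure Tc
  [instμ₁ : IsProbabilityMeasure μ]
  [instμ₂ : μ.IsMulLeftInvariant]
  /-- the embedding `T(L₀ ⊗ ℝ) → U(W)(𝔸)`, a continuous homomorphism -/
  ιT : Tc →* G
  ιT_cont : Continuous ιT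
  /-- the weight character `w = χ_∞|_{T(L₀⊗ℝ)}` of the isolated type, continuous and unitary -/
  w : Tc →* ℂ
  w_cont : Continuous w
  w_norm : ∀ t, ‖w t‖ = 1
  /-- the torus side's weight space IS the joint eigenspace of `(ιT, w)`. -/
  Ew_eq : D.Ew = RepDecomp.Ew C.R ιT w
  /-- the compact Hausdorff abelian group `[T] = T(L₀)\T(𝔸)` -/
  K : Type
  [instK₁ : CommGroup K]
  [instK₂ : TopologicalSpace K]
  [instK₃ : IsTopologicalGroup K]
  [instK₄ : CompactSpace K]
  [instK₇ : T2Space K]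
  [instK₅ : MeasurableSpace K]
  [instK₆ : BorelSpace K]
  /-- its Haar measure (finite, positive on opens, right invariant) -/
  μK : Measure K
  [instμK₁ : IsFiniteMeasure μK]
  [instμK₂ : μK.IsOpenPosMeasure]
  [instμK₃ : μK.IsMulRightInvariant]
  /-- the adelic points `T(𝔸)` (or any set of representatives), mapped into `U(W)(𝔸)` and onto `[T]` -/
  TA : Type
  ιA : TA → G
  q : TA → K
  /-- restriction of a continuous function on `[U(W)]` to `[T]`: `res x (q a) = x(Γ ιA(a))` (e.g. `resCLM φ` for the continuous
  equivariant map `φ : [T] → [U(W)]`, with `res_spec`, `res_transl` = `resCLM_spec`, `resCLM_transl`) -/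
  res : C(G ⧸ Γ, ℂ) →L[ℂ] C(K, ℂ)
  res_spec : ∀ (x : C(G ⧸ Γ, ℂ)) (a : TA), res x (q a) = evC (ιA a) x
  /-- the class map `T(L₀ ⊗ ℝ) → [T]` and the equivariance of `res` under it -/
  cl : Tc →* K
  res_transl : ∀ (t : Tc) (x : C(G ⧸ Γ, ℂ)) (k : K), res (translC (ιT t) x) k = res x (k * cl t)
  /-- the allowed characters among the characters of `[T]` -/
  emb : D.X → PontryaginDual K
  /-- ll. 425–427: a character of `[T]` with `ξ_∞ = w` is allowed. -/
  emb_surj : ∀ ξ : PontryaginDual K, (dualChar ξ).comp cl = w → ∃ χ : D.X, emb χ = ξ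
  /-- the finite-adelic factor `U(W)(𝔸_f)` -/
  Gf : Type
  [instGf : Group Gf]
  ιf : Gf →* G
  comm : ∀ (hf : Gf) (t : Tc), ιf hf * ιT t = ιT t * ιf hf
  /-- [AX12(ii)] the unfolding identity, consequence form. -/
  unfold : ∀ (x : C(G ⧸ Γ, ℂ)) (χ : D.X), (∀ f, ⟪D.E χ f, ContinuousMap.toLp (E := ℂ) 2 ν ℂ x⟫ = 0) →
    ∀ h : G, periodCLM μK (emb χ) (res (translC h x)) = 0
  /-- [PRINT] `U(W)(L₀) · T(𝔸) · U(W)(𝔸_f)` is dense in `U(W)(𝔸)` (kernel supplement `AnnihilationDense`). -/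
  dense : Dense {g : G | ∃ γ ∈ Γ, ∃ (t : TA) (hf : Gf), g = γ * ιA t * ιf hf}

attribute [instance] CompactTorusDatum.instTc₁ CompactTorusDatum.instTc₂ CompactTorusDatum.instTc₃
  CompactTorusDatum.instTc₄ CompactTorusDatum.instTc₅ CompactTorusDatum.instTc₆
  CompactTorusDatum.instμ₁ CompactTorusDatum.instμ₂
  CompactTorusDatum.instK₁ CompactTorusDatum.instK₂ CompactTorusDatum.instK₃ CompactTorusDatum.instK₄
  CompactTorusDatum.instK₇ CompactTorusDatum.instK₅ CompactTorusDatum.instK₆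
  CompactTorusDatum.instμK₁ CompactTorusDatum.instμK₂ CompactTorusDatum.instμK₃ CompactTorusDatum.instGf

namespace CompactTorusDatum

variable {ν}
variable {C : RepCoreCarrier (Lp ℂ 2 ν) HG CG G SK SigIdxG} {D : RepTorusCarrier C}

/-- **`CompactTorusDatum → QuotientTorusDatum`**: `Xall := PontryaginDual K`, `χinf ξ := ξ ∘ cl`, `PT ξ := periodCLM μK ξ ∘ res`;
`PT_cov` by `periodCLM_translate`, `fourier` by `eq_zero_of_forall_periodCLM` + `CharSeparation.charSeparating`. -/
def toQuotient (B : CompactTorusDatum ν C D) : QuotientTorusDatum ν C D where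
  Tc := B.Tc
  μ := B.μ
  ιT := B.ιT
  ιT_cont := B.ιT_cont
  w := B.w
  w_cont := B.w_cont
  w_norm := B.w_norm
  Ew_eq := B.Ew_eq
  Xall := PontryaginDual B.K
  emb := B.emb
  χinf := fun ξ => (dualChar ξ).comp B.cl
  emb_surj := B.emb_surj
  PT := fun ξ => (periodCLM B.μK ξ).comp B.res
  PT_cov := fun ξ t x => by
    rw [ContinuousLinearMap.comp_apply, ContinuousLinearMap.comp_apply, MonoidHom.comp_apply]
    exact periodCLM_translate B.μK ξ (B.res x) _ (B.cl t) (B.res_transl t x)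
  Gf := B.Gf
  ιf := B.ιf
  comm := B.comm
  unfold := B.unfold
  TA := B.TA
  ιA := B.ιA
  fourier := fun x hx a => by
    have h0 : B.res x = 0 := eq_zero_of_forall_periodCLM B.μK CharSeparation.charSeparating (B.res x) fun ξ => hx ξ
    rw [← B.res_spec, h0, ContinuousMap.zero_apply]
  dense := B.dense

variable [SMulInvariantMeasure G (G ⧸ Γ) ν] [T2Space (G ⧸ Γ)] [ν.InnerRegularCompactLTTop]

/-- The full annihilation datum of a compact-model torus datum. -/
def toRep (B : CompactTorusDatum ν C D) (S : SmoothingData ν C.R) (hR : C.R = ρHom ν) : RepAnnihilationDatum C D :=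
  B.toQuotient.toRep S hR

/-- **[AX8] over the compact model.** -/
theorem AX8_annihilation (B : CompactTorusDatum ν C D) (S : SmoothingData ν C.R) (hR : C.R = ρHom ν)
    (hC : C.Analytic) (h12a : ∀ (h : G) χ f, C.R h (D.E χ f) = D.E χ (D.ETransl h χ f)) (v : Lp ℂ 2 ν)
    (hv : ∀ χ f, ⟪D.E χ f, v⟫ = 0) : D.toTorusCarrier.Pw v = 0 :=
  B.toQuotient.AX8_annihilation S hR hC h12a v hv

/-- `RepTorusCarrier.Analytic` over the compact model = `Analytic5` + a `CompactTorusDatum` + `SmoothingData`. -/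
theorem analytic (h5 : D.Analytic5) (B : CompactTorusDatum ν C D) (S : SmoothingData ν C.R) (hR : C.R = ρHom ν)
    (hC : C.Analytic) : D.Analytic :=
  analytic_of_quotientTorusDatum h5 B.toQuotient S hR hC

end CompactTorusDatum

end CompactModel

/-! ## §3  `[SETUP D7]` for Haar measure: the smoothing data CONSTRUCTED -/
section Haar

variable {G : Type} [Group G] [TopologicalSpace G] [IsTopologicalGroup G] [LocallyCompactSpace G]
  [MeasurableSpace G] [BorelSpace G] {Γ : Subgroup G} [DiscreteTopology Γ] [Countable Γ]
  (hΓ : IsClosed (Γ : Set G))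
  [MeasurableSpace (G ⧸ Γ)] [BorelSpace (G ⧸ Γ)] [CompactSpace (G ⧸ Γ)]
  (μ : Measure G) [Measure.IsHaarMeasure μ] [μ.Regular] [μ.IsMulRightInvariant]
  {𝓕 : Set G} (h𝓕 : IsFundamentalDomain Γ.op 𝓕 μ)

/-- **The `[SETUP D7]` fields over the cocompact model, for Haar measure on a first-countable `G`.**  `G` locally compact,
first countable, `Γ` discrete countable closed cocompact, `μ` a regular Haar measure on the unimodular `G`, `𝓕` a
fundamental domain, `ν = π_*(μ|𝓕)`: an approximate identity `(f_n) ⊂ C_c(G)` exists (`ApproxIdentity.exists_isApproxIdentity`;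
`G` is T₂ by `CompactApprox.t2Space_of_isClosed`), and `sm n := R(f_n) = ∫ f_n(g) ρ(g) dμ(g)` has `sm_tendsto`
(`smOp_tendsto`), `sm_mem` (`smOp_mem_of_invariant`) and `sm_cont` (`QuotientSmoothingHaar.sm_cont_haar'`: `R(f_n)` is an
integral operator with continuous kernel). -/
def smoothingData_haar [FirstCountableTopology G] :
    haveI := smulInvariantMeasure_map_restrict μ h𝓕
    haveI := isFiniteMeasure_map_restrict (Γ := Γ) μ (measure_fundamentalDomain_lt_top μ h𝓕).ne
    SmoothingData (Measure.map (QuotientGroup.mk : G → G ⧸ Γ) (μ.restrict 𝓕))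
      (ρHom (Measure.map (QuotientGroup.mk : G → G ⧸ Γ) (μ.restrict 𝓕))) := by
  haveI := hΓ
  haveI := smulInvariantMeasure_map_restrict μ h𝓕
  haveI := isFiniteMeasure_map_restrict (Γ := Γ) μ (measure_fundamentalDomain_lt_top μ h𝓕).ne
  haveI := innerRegularCompactLTTop_map_restrict (Γ := Γ) μ 𝓕
  haveI : T2Space G := CompactApprox.t2Space_of_isClosed hΓ
  have hf := Classical.choose_spec (ApproxIdentity.exists_isApproxIdentity μ)
  exact
    { sm := fun n => smOpX _ μ (Classical.choose (ApproxIdentity.exists_isApproxIdentity μ) n) (hf.cont n) (hf.cpt n)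
      sm_tendsto := fun v => ApproxIdentity.smOp_tendsto μ (ρHom _) (continuous_ρ_apply _) 1 (opNorm_ρ_le_one _) hf v
      sm_mem := fun M hM hinv n v hv => ApproxIdentity.smOp_mem_of_invariant μ (ρHom _) (continuous_ρ_apply _) 1
        (opNorm_ρ_le_one _) _ (hf.cont n) (hf.cpt n) M hM hinv hv
      sm_cont := sm_cont_haar' hΓ μ h𝓕 _ hf.cont hf.cpt }

end Haar

end PerL34.Annihilation
end HodgeCM

end
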